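import Summits.ResolutionOfSingularities.ResolutionOfSingularities.Theorems.WeightedInvariantLocalWeightedDropNCToricRung
import Summits.ResolutionOfSingularities.ResolutionOfSingularities.Theorems.WeightedInvariantLocalWeightedDropNCSmoothPower
import Summits.ResolutionOfSingularities.ResolutionOfSingularities.Theorems.WeightedInvariantLocalWeightedDropMonomialPhaseChart

/-!
# `LocalWeightedDrop`, line `nc-game-transport`, TOT rung R6 (Newton non-degenerate germs): `ToricEnd`, PART 1/2 — bookkeeping of a toric
# state (substitution, cloud vectors, weight, face, log-Jacobian) and the logarithmic Leibniz rule

[OURS · L1 W4.3 · chain w43, engine crux `LocalWeightedDrop` stmt-ResolutionOfSingularities-8899; strategist res-L1-w43-strat-1's line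
`nc-game-transport`, rung R6 `NCTransport.TOTRungNonDegenerate` (`…NCToricRung`, the strategist's sketch landed verbatim by res-D-pv-006,
p518559; `TOT-RUNGS-SPEC.md` v3 §R6 (c), `R6-PROVER-NOTES.md` §2); piece (c) → res-type-088 (NAMING 09:20:38Z).]  Nothing here is a
statement of any manuscript; the count game and the toric bookkeeping are the programme's own.

**`toricEnd (m) : NCTransport.ToricEnd m`.**  Data: a toric state `st : ToricState b B` — the original germ `b` read through
`xᵢ ↦ (∏ₜ Xₜ^{cols t i})·uᵢ` (units `uᵢ`, toric slots `T`, invertible log-Jacobian) is `X^d·h`, the position is `B = v·X^c·h` —, a covering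
set `S₀` of exponents of `b` whose cloud `{E(a) = cols·a}` is a CHAIN, and Newton non-degeneracy of `b`.  Proof (Ishii-type face computation):
(E1) the chain has a least vector `e₀ = E(a₀)`, and `E(β) ≥ e₀` for every `β ∈ supp b` (`Covers`); (E2) hence `b∘x = X^{e₀}·q`
(`coeff_subst`), with `q(0) = g(ū)` and, at a LOG slot `z ∉ T`, `∂_z q(0) = Σᵢ L_{z i} Vᵢ` — only the FACE `F = {β ∈ supp b : E(β) = e₀}`
`= supp in_W b` (`W = Σₜ cols t`, positive) contributes, `g(ū) = Σ_F b_β ū^β`, `Vᵢ = Σ_F βᵢ b_β ū^β`, `L` = the log-Jacobian matrix;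
(E3) the toric rows give `Σᵢ cols t i · Vᵢ = e₀(t)·g(ū)`; (E4) `TorusSmooth (in_W b)` read through `Xᵢ ↦ ūᵢ·t^{Wᵢ}` forbids
`g(ū) = 0 ∧ V = 0`; (E5) so `g(ū) ≠ 0`, or `L·V` vanishes on `T` and `V ≠ 0`, whence (invertibility) a log slot with `∂_z q(0) ≠ 0`;
(E6) comparing `X^d·h = X^{e₀}·q` gives `d ≤ e₀`, `h = X^{e₀−d}·q`, `B = v·X^{c+e₀−d}·q` — a unit monomial (`germIsNC_of_unitMonomial`)
or a smooth germ with a log-variable linear term times a unit monomial in the other variables (`germIsNC_of_smooth_mul_unitMonomial`, R0).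
-/

set_option linter.dupNamespace false -- mandated namespace of this single-conjunct summit

namespace Summit.ResolutionOfSingularities.ResolutionOfSingularities.Theorems

namespace NCTransport

namespace ToricEndProof

open MvPowerSeries Literature.AlgebraicGeometry.Resolution TameFourTupleDrop

variable {k : Type} [Field k] {m : ℕ}

/-! ## Linear coefficients: Leibniz -/

/-- Leibniz at degree one: `[X_z](F·G) = F(0)·[X_z]G + [X_z]F·G(0)`. [folklore] -/
theorem coeff_single_one_mul {n : ℕ} (z : Fin n) (F G : MvPowerSeries (Fin n) k) :
    coeff (Finsupp.single z 1) (F * G) = constantCoeff F * coeff (Finsupp.single z 1) G + coeff (Finsupp.single z 1) F * constantCoeff G := by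
  classical
  rw [coeff_mul, Finsupp.antidiagonal_single, Finset.sum_map, Finset.Nat.antidiagonal_succ, Finset.sum_cons, Finset.Nat.antidiagonal_zero,
    Finset.map_singleton, Finset.sum_singleton]
  simp only [Function.Embedding.coe_prodMap, Function.Embedding.coeFn_mk, Prod.map_apply, Function.Embedding.refl_apply,
    Finsupp.single_zero, coeff_zero_eq_constantCoeff_apply]

/-- Linear coefficient of a power: `[X_z](F^e) = e·F(0)^{e-1}·[X_z]F`. [folklore] -/
theorem coeff_single_one_pow {n : ℕ} (z : Fin n) (F : MvPowerSeries (Fin n) k) (e : ℕ) :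
    coeff (Finsupp.single z 1) (F ^ e) = (e : k) * constantCoeff F ^ (e - 1) * coeff (Finsupp.single z 1) F := by
  induction e with
  | zero =>
    rw [pow_zero, coeff_one, if_neg (Finsupp.single_ne_zero.mpr one_ne_zero), Nat.cast_zero, zero_mul, zero_mul]
  | succ e ih =>
    rw [pow_succ, coeff_single_one_mul, ih, map_pow, Nat.cast_succ, Nat.add_sub_cancel]
    cases e with
    | zero => simp
    | succ e =>
      rw [Nat.add_sub_cancel, pow_succ]
      ring

/-- LOGARITHMIC LEIBNIZ for a product of powers of UNITS: `[X_z](∏ᵢ uᵢ^{βᵢ}) = (∏ᵢ uᵢ(0)^{βᵢ}) · Σᵢ βᵢ·[X_z]uᵢ·uᵢ(0)⁻¹`. [folklore] -/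
theorem coeff_single_one_prod_pow {n : ℕ} {ι : Type} (s : Finset ι) (z : Fin n) (u : ι → MvPowerSeries (Fin n) k)
    (hu : ∀ i ∈ s, constantCoeff (u i) ≠ 0) (β : ι → ℕ) :
    coeff (Finsupp.single z 1) (∏ i ∈ s, u i ^ β i) =
      (∏ i ∈ s, constantCoeff (u i) ^ β i) * ∑ i ∈ s, (β i : k) * coeff (Finsupp.single z 1) (u i) * (constantCoeff (u i))⁻¹ := by
  classical
  induction s using Finset.induction_on with
  | empty => simp [coeff_one, Finsupp.single_ne_zero.mpr one_ne_zero]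
  | insert a s ha ih =>
    rw [Finset.prod_insert ha, Finset.prod_insert ha, Finset.sum_insert ha, coeff_single_one_mul,
      ih (fun i hi => hu i (Finset.mem_insert_of_mem hi)), map_prod, coeff_single_one_pow, map_pow]
    simp_rw [map_pow]
    have ha0 : constantCoeff (u a) ≠ 0 := hu a (Finset.mem_insert_self a s)
    rcases Nat.eq_zero_or_pos (β a) with h0 | hpos
    · rw [h0]; simp
    · obtain ⟨e, he⟩ : ∃ e, β a = e + 1 := ⟨β a - 1, by omega⟩
      rw [he, Nat.add_sub_cancel, pow_succ]
      field_simp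
      ring

/-! ## The substitution of a toric state -/

variable {b B : MvPowerSeries (Fin (m + 1)) k}

/-- The exponent ROW-vector `E(β) = (Σᵢ cols t i · βᵢ)ₜ` of the image of `x^β` (the cloud vector of `β`). -/
def E (st : ToricState b B) (β : Fin (m + 1) →₀ ℕ) : Fin (m + 1) → ℕ := fun t => ∑ i, st.cols t i * β i

/-- The positive weight `W i = Σₜ cols t i`. -/
def W (st : ToricState b B) : Fin (m + 1) → ℕ := fun i => ∑ t, st.cols t i

/-- The substitution `xᵢ ↦ (∏ₜ Xₜ^{cols t i})·uᵢ` of the state. -/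
noncomputable def xs (st : ToricState b B) : Fin (m + 1) → MvPowerSeries (Fin (m + 1)) k :=
  fun i => (∏ t, X t ^ st.cols t i) * st.u i

/-- The unit part `∏ᵢ uᵢ^{βᵢ}`. -/
noncomputable def U (st : ToricState b B) (β : Fin (m + 1) →₀ ℕ) : MvPowerSeries (Fin (m + 1)) k := ∏ i, st.u i ^ β i

/-- `ūᵢ = uᵢ(0)`. -/
noncomputable def ubar (st : ToricState b B) : Fin (m + 1) → k := fun i => constantCoeff (st.u i)

/-- The cloud of a toric state is `E`. -/
theorem cloud_eq_E (st : ToricState b B) (S₀ : Finset (Fin (m + 1) →₀ ℕ)) (a : ↥S₀) : st.cloud S₀ a = E st a := rfl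

/-- `E` is monotone. -/
theorem E_mono (st : ToricState b B) {β β' : Fin (m + 1) →₀ ℕ} (h : β ≤ β') (t : Fin (m + 1)) : E st β t ≤ E st β' t :=
  Finset.sum_le_sum fun i _ => Nat.mul_le_mul_left _ (h i)

/-- `E(β)` vanishes off `T`. -/
theorem E_eq_zero_of_not_mem (st : ToricState b B) (β : Fin (m + 1) →₀ ℕ) {t : Fin (m + 1)} (ht : t ∉ st.T) : E st β t = 0 := by
  unfold E
  exact Finset.sum_eq_zero fun i _ => by rw [st.cols_zero t ht i, zero_mul]

/-- The weight is positive. -/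
theorem W_ne_zero (st : ToricState b B) (i : Fin (m + 1)) : W st i ≠ 0 := by
  obtain ⟨t, -, ht⟩ := st.col_pos i
  exact Nat.pos_iff_ne_zero.mp (lt_of_lt_of_le ht (Finset.single_le_sum (f := fun t => st.cols t i) (fun _ _ => Nat.zero_le _)
    (Finset.mem_univ t)))

/-- `weight W β = Σₜ E(β) t`. -/
theorem weight_eq_sum_E (st : ToricState b B) (β : Fin (m + 1) →₀ ℕ) : Finsupp.weight (W st) β = ∑ t, E st β t := by
  rw [Finsupp.weight_apply, Finsupp.sum_fintype _ _ (fun i => by simp)]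
  unfold W E
  simp only [smul_eq_mul, Finset.mul_sum]
  rw [Finset.sum_comm]
  exact Finset.sum_congr rfl fun t _ => Finset.sum_congr rfl fun i _ => by ring

/-- The substitution is legal (constant terms vanish: every column is non-zero). -/
theorem constantCoeff_xs (st : ToricState b B) (i : Fin (m + 1)) : constantCoeff (xs st i) = 0 := by
  obtain ⟨t, -, ht⟩ := st.col_pos i
  unfold xs
  rw [map_mul, map_prod]
  have h0 : constantCoeff ((X t : MvPowerSeries (Fin (m + 1)) k) ^ st.cols t i) = 0 := by
    rw [map_pow, constantCoeff_X, zero_pow (Nat.pos_iff_ne_zero.mp ht)]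
  rw [Finset.prod_eq_zero (Finset.mem_univ t) h0, zero_mul]

/-- The substitution of a toric state is substitutable. -/
theorem hasSubst_xs (st : ToricState b B) : HasSubst (xs st) := hasSubst_of_constantCoeff_zero (constantCoeff_xs st)

/-- `∏ᵢ xᵢ^{βᵢ} = X^{E(β)} · ∏ᵢ uᵢ^{βᵢ}`. -/
theorem prod_xs_pow (st : ToricState b B) (β : Fin (m + 1) →₀ ℕ) :
    (β.prod fun s e => xs st s ^ e) = monomial (Finsupp.equivFunOnFinite.symm (E st β)) 1 * U st β := by
  rw [Finsupp.prod_fintype _ _ (fun i => pow_zero _), ← MonomialWon.prod_X_pow_eq_monomial]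
  unfold xs U E
  have h1 : ∀ i, ((∏ t, (X t : MvPowerSeries (Fin (m + 1)) k) ^ st.cols t i) * st.u i) ^ β i =
      (∏ t, (X t : MvPowerSeries (Fin (m + 1)) k) ^ (st.cols t i * β i)) * st.u i ^ β i := by
    intro i
    rw [mul_pow, ← Finset.prod_pow]
    simp_rw [← pow_mul]
  simp_rw [h1]
  rw [Finset.prod_mul_distrib, Finset.prod_comm]
  congr 1
  exact Finset.prod_congr rfl fun t _ => Finset.prod_pow_eq_pow_sum _ _ _

/-- THE COEFFICIENT FORMULA for `b∘x`. -/
theorem coeff_subst_xs (st : ToricState b B) (n : Fin (m + 1) →₀ ℕ) :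
    coeff n (subst (xs st) b) = ∑ᶠ β : Fin (m + 1) →₀ ℕ, coeff β b *
      (if Finsupp.equivFunOnFinite.symm (E st β) ≤ n then coeff (n - Finsupp.equivFunOnFinite.symm (E st β)) (U st β) else 0) := by
  rw [coeff_subst (hasSubst_xs st)]
  refine finsum_congr fun β => ?_
  rw [prod_xs_pow, coeff_monomial_mul, smul_eq_mul]
  split_ifs <;> simp

/-! ## The least cloud vector and the face -/

section Face

variable (st : ToricState b B) (e₀ : Fin (m + 1) → ℕ)

/-- The face data: exponents of `b` of cloud vector exactly `e₀`, as a finite set (the level set of the positive weight `W`). -/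
noncomputable def face : Finset (Fin (m + 1) →₀ ℕ) := by
  classical
  exact (Finsupp.finite_of_nat_weight_le (W st) (W_ne_zero st) (∑ t, e₀ t)).toFinset.filter
    (fun β => E st β = e₀ ∧ coeff β b ≠ 0)

variable {st e₀}

/-- Membership in the face. -/
theorem mem_face {β : Fin (m + 1) →₀ ℕ} : β ∈ face st e₀ ↔ E st β = e₀ ∧ coeff β b ≠ 0 := by
  classical
  unfold face
  rw [Finset.mem_filter, Set.Finite.mem_toFinset, Set.mem_setOf_eq]
  constructor
  · exact fun h => h.2
  · intro h
    refine ⟨?_, h⟩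
    rw [weight_eq_sum_E, h.1]

/-- Under `e₀ ≤ E(β)` (componentwise), `E(β) ≤ e₀` forces `β` onto the face. -/
theorem E_eq_of_le {β : Fin (m + 1) →₀ ℕ} (hge : ∀ t, e₀ t ≤ E st β t) (hle : ∀ t, E st β t ≤ e₀ t) : E st β = e₀ :=
  funext fun t => le_antisymm (hle t) (hge t)

end Face

/-- `g(ū) = Σ_{β ∈ F} b_β ū^β`. -/
noncomputable def gbar (st : ToricState b B) (e₀ : Fin (m + 1) → ℕ) : k :=
  ∑ β ∈ face st e₀, coeff β b * ∏ i, ubar st i ^ β i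

/-- `Vᵢ = Σ_{β ∈ F} βᵢ b_β ū^β`. -/
noncomputable def V (st : ToricState b B) (e₀ : Fin (m + 1) → ℕ) (i : Fin (m + 1)) : k :=
  ∑ β ∈ face st e₀, (β i : k) * coeff β b * ∏ j, ubar st j ^ β j

/-- The LOG-JACOBIAN matrix of the state (the matrix of `st.logJac`). -/
noncomputable def L (st : ToricState b B) : Matrix (Fin (m + 1)) (Fin (m + 1)) k :=
  Matrix.of fun t i => if t ∈ st.T then ((st.cols t i : ℕ) : k) else coeff (Finsupp.single t 1) (st.u i) * (constantCoeff (st.u i))⁻¹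

/-- The log-Jacobian matrix is invertible. -/
theorem isUnit_L (st : ToricState b B) : IsUnit (L st) := (Matrix.isUnit_iff_isUnit_det _).mpr st.logJac

end ToricEndProof

end NCTransport

end Summit.ResolutionOfSingularities.ResolutionOfSingularities.Theorems
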